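import Literature.Analysis.FunctionSpaces.EuclideanLogSobolev
import Mathlib.Analysis.Calculus.Rademacher
import Mathlib.Analysis.Calculus.BumpFunction.Convolution
import Mathlib.Analysis.Calculus.BumpFunction.InnerProduct
import Mathlib.Analysis.Calculus.ContDiff.Convolution
import Mathlib.Analysis.Calculus.FDeriv.Measurable
import HarnessLib

/-!
# The sharp Euclidean logarithmic Sobolev inequality for Lipschitz functions

Topic `Literature/Analysis/FunctionSpaces`; sequel of `EuclideanLogSobolev.lean`, which proves the
sharp Euclidean logarithmic Sobolev inequality of Weissler and Carlen (Bakry–Gentil–Ledoux 2014,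
Prop. 6.2.5) in the scale form `∫ f² log f² ≤ 4τ ∫ ‖Df‖² − n − (n/2) log(4πτ)` for `C¹` compactly
supported `f` with `∫ f² dx = 1`. Here the test class is enlarged to **compactly supported Lipschitz
functions** (`euclideanLogSobolev_scale_of_lipschitz`, and its case `n = 4`,
`euclideanLogSobolev_scale_four_of_lipschitz`), `Df = fderiv ℝ f` being the Fréchet derivative,
which exists a.e. by Rademacher's theorem (Mathlib `LipschitzWith.ae_differentiableAt`) and is `0`
by convention elsewhere. This is the class in which the inequality is USED in the proof of the sharp
log-Sobolev inequality under `Ric ≥ 0` (Balogh–Kristály–Tripaldi 2024, §3.1: it is applied to the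
non-increasing rearrangement `û`, a Lipschitz function, through the model-space inequality (2.5)).

The proof is the standard mollification argument, carried out with Mathlib's normed bump functions
`ContDiffBump.normed` and convolution `⋆`:

* `contDiff_normed_convolution`, `hasCompactSupport_normed_convolution`,
  `dist_normed_convolution_le_of_lipschitz` (`|φ ⋆ f − f| ≤ C r_out`), `abs_normed_convolution_le`,
  `normed_convolution_eq_zero_of_infDist` — smoothness, support and uniform approximation;
* `fderiv_normed_convolution_apply` — **differentiation under the integral sign for a Lipschitz
  `f`**: `D(φ ⋆ f)_x(v) = ∫ ∂_v f(y) φ(x − y) dy` (dominated convergence of difference quotients,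
  Mathlib `LipschitzWith.integral_inv_smul_sub_mul_tendsto_integral_lineDeriv_mul`);
* `norm_fderiv_normed_convolution_sq_le`, `integral_norm_fderiv_normed_convolution_sq_le` — **the
  Dirichlet energy does not increase under mollification**, `∫ ‖D(φ ⋆ f)‖² ≤ ∫ ‖Df‖²` (Jensen for
  the probability density `φ(x − ·)`, then `∫ (‖Df‖² ⋆ φ) = ∫ ‖Df‖²`);
* `euclideanLogSobolev_scale_homogeneous` — the `C¹` inequality for un-normalised `g`
  (`∫ g² log g² − a log a ≤ 4τ ∫ ‖Dg‖² − a (n + (n/2) log(4πτ))`, `a = ∫ g²`);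
* `euclideanLogSobolev_scale_of_lipschitz` — the limit along `φ_k ⋆ f`, `r_out(φ_k) = 1/(k+1)`
  (dominated convergence for `∫ f_k²` and `∫ f_k² log f_k²` on a common compact support);
* `euclideanLogSobolev_scale_homogeneous_of_lipschitz` (and `…_four_of_lipschitz`) — the
  Lipschitz inequality for un-normalised `g` (the form consumed by limiting arguments along
  approximate rearrangements, where `∫ g² → 1` only in the limit).

Everything is proved; no definitions, no named facts. What is NOT here: general `W^{1,2}` test
functions, equality cases.

## References

* [BakryGentilLedoux2014] D. Bakry, I. Gentil, M. Ledoux, *Analysis and Geometry of Markov Diffusion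
  Operators*, Springer 2014, Prop. 6.2.5 (p. 284).
* [BaloghKristalyTripaldi2024] Z. M. Balogh, A. Kristály, F. Tripaldi, J. Funct. Anal. 286 (2024)
  110217, §2.2 (2.5) and §3.1 (use for the Lipschitz rearrangement `û`).
-/

noncomputable section

open MeasureTheory Set Filter Topology Metric ContinuousLinearMap
open scoped RealInnerProductSpace ENNReal NNReal Convolution

namespace Literature.Analysis.FunctionSpaces

variable {n : ℕ}

/-! ### Mollification of a Lipschitz function by a normed bump function -/

section Mollify

variable {f : EuclideanSpace ℝ (Fin n) → ℝ} {C : ℝ≥0}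

/-- The mollification `φ ⋆ f` of a continuous function by a normed bump function is `C¹`. [folklore] -/
theorem contDiff_normed_convolution (φ : ContDiffBump (0 : EuclideanSpace ℝ (Fin n)))
    (hf : Continuous f) : ContDiff ℝ 1 (φ.normed volume ⋆ f) :=
  φ.hasCompactSupport_normed.contDiff_convolution_left (lsmul ℝ ℝ) (φ.contDiff_normed (n := 1))
    (hf.locallyIntegrable (μ := volume))

/-- The mollification of a compactly supported function has compact support. [folklore] -/
theorem hasCompactSupport_normed_convolution (φ : ContDiffBump (0 : EuclideanSpace ℝ (Fin n)))
    (hfs : HasCompactSupport f) : HasCompactSupport (φ.normed volume ⋆ f) :=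
  φ.hasCompactSupport_normed.convolution _ hfs

/-- **Uniform approximation**: `|φ ⋆ f (x) − f(x)| ≤ C · r_out(φ)` for a `C`-Lipschitz `f`. [folklore] -/
theorem dist_normed_convolution_le_of_lipschitz (φ : ContDiffBump (0 : EuclideanSpace ℝ (Fin n)))
    (hf : LipschitzWith C f) (x : EuclideanSpace ℝ (Fin n)) :
    dist ((φ.normed volume ⋆ f) x) (f x) ≤ C * φ.rOut := by
  refine φ.dist_normed_convolution_le hf.continuous.aestronglyMeasurable fun y hy ↦ ?_
  rw [mem_ball] at hy
  exact (hf.dist_le_mul y x).trans (by gcongr)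

/-- The mollification vanishes at distance `≥ r_out(φ)` from the support of `f`. [folklore] -/
theorem normed_convolution_eq_zero_of_infDist (φ : ContDiffBump (0 : EuclideanSpace ℝ (Fin n)))
    {x : EuclideanSpace ℝ (Fin n)} (hx : x ∉ thickening φ.rOut (Function.support f)) :
    (φ.normed volume ⋆ f) x = 0 := by
  by_contra h
  have hmem : x ∈ Function.support (φ.normed volume ⋆ f) := h
  have h2 := support_convolution_subset_swap (L := lsmul ℝ ℝ) (μ := volume) hmem
  rw [φ.support_normed_eq] at h2
  obtain ⟨a, ha, b, hb, rfl⟩ := h2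
  refine hx (mem_thickening_iff.2 ⟨a, ha, ?_⟩)
  rw [mem_ball, dist_zero_right] at hb
  rwa [dist_eq_norm, add_sub_cancel_left]

/-- `|φ ⋆ f| ≤ sup |f|`: a convolution with a probability density does not increase the sup norm.
[folklore] -/
theorem abs_normed_convolution_le (φ : ContDiffBump (0 : EuclideanSpace ℝ (Fin n)))
    {B : ℝ} (hB : ∀ y, |f y| ≤ B) (x : EuclideanSpace ℝ (Fin n)) :
    |(φ.normed volume ⋆ f) x| ≤ B := by
  rw [convolution_def]
  simp only [lsmul_apply, smul_eq_mul]
  have hB0 : 0 ≤ B := (abs_nonneg _).trans (hB 0)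
  have hint : Integrable (fun t ↦ φ.normed volume t * B) volume := φ.integrable_normed.mul_const B
  calc |∫ t, φ.normed volume t * f (x - t)|
      ≤ ∫ t, |φ.normed volume t * f (x - t)| := by
        simpa only [Real.norm_eq_abs] using norm_integral_le_integral_norm (μ := volume)
          (fun t ↦ φ.normed volume t * f (x - t))
    _ ≤ ∫ t, φ.normed volume t * B := by
        refine integral_mono_of_nonneg (Eventually.of_forall fun t ↦ abs_nonneg _) hint
          (Eventually.of_forall fun t ↦ ?_)
        change |φ.normed volume t * f (x - t)| ≤ φ.normed volume t * B
        rw [abs_mul, abs_of_nonneg (φ.nonneg_normed t)]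
        exact mul_le_mul_of_nonneg_left (hB _) (φ.nonneg_normed t)
    _ = B := by rw [integral_mul_const, φ.integral_normed, one_mul]

/-- The mollification written with the kernel on the right: `(φ ⋆ f)(z) = ∫ φ(z − y) f(y) dy`. [folklore] -/
theorem normed_convolution_eq (φ : ContDiffBump (0 : EuclideanSpace ℝ (Fin n)))
    (z : EuclideanSpace ℝ (Fin n)) :
    (φ.normed volume ⋆ f) z = ∫ y, f y * φ.normed volume (z - y) := by
  rw [convolution_def, ← integral_sub_left_eq_self _ volume z]
  refine integral_congr_ae (Eventually.of_forall fun y ↦ ?_)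
  simp only [lsmul_apply, smul_eq_mul, sub_sub_cancel, mul_comm]

/-- The translated kernel `y ↦ φ(x − y)` is integrable. [folklore] -/
theorem integrable_normed_sub (φ : ContDiffBump (0 : EuclideanSpace ℝ (Fin n)))
    (x : EuclideanSpace ℝ (Fin n)) : Integrable (fun y ↦ φ.normed volume (x - y)) volume :=
  (φ.continuous_normed.comp (continuous_const.sub continuous_id)).integrable_of_hasCompactSupport
    (φ.hasCompactSupport_normed.comp_homeomorph (Homeomorph.subLeft x))

/-- **Differentiating the mollification of a Lipschitz function under the integral**:
`D(φ ⋆ f)_x(v) = ∫ ∂_v f(y) φ(x − y) dy`, the directional derivative `∂_v f = lineDeriv f · v`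
existing a.e. (Rademacher) and being bounded (dominated convergence, Mathlib's
`LipschitzWith.integral_inv_smul_sub_mul_tendsto_integral_lineDeriv_mul`). [folklore] -/
theorem fderiv_normed_convolution_apply (φ : ContDiffBump (0 : EuclideanSpace ℝ (Fin n)))
    (hf : LipschitzWith C f) (x v : EuclideanSpace ℝ (Fin n)) :
    fderiv ℝ (φ.normed volume ⋆ f) x v = ∫ y, lineDeriv ℝ f y v * φ.normed volume (x - y) := by
  set F := φ.normed volume ⋆ f with hF
  have hFd : ContDiff ℝ 1 F := contDiff_normed_convolution φ hf.continuous
  have h1 : Tendsto (fun t : ℝ ↦ t⁻¹ • (F (x + t • v) - F x)) (𝓝[>] 0) (𝓝 (fderiv ℝ F x v)) :=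
    (((hFd.differentiable one_ne_zero) x).hasFDerivAt.hasLineDerivAt v).tendsto_slope_zero_right
  have h2 : ∀ t : ℝ, t⁻¹ • (F (x + t • v) - F x) =
      ∫ y, (t⁻¹ • (f (y + t • v) - f y)) * φ.normed volume (x - y) := by
    intro t
    have hi1 : Integrable (fun y ↦ f (y + t • v) * φ.normed volume (x - y)) volume :=
      ((hf.continuous.comp (continuous_id.add continuous_const)).mul
        (φ.continuous_normed.comp (continuous_const.sub continuous_id))).integrable_of_hasCompactSupport
        (φ.hasCompactSupport_normed.comp_homeomorph (Homeomorph.subLeft x)).mul_left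
    have hi2 : Integrable (fun y ↦ f y * φ.normed volume (x - y)) volume :=
      (hf.continuous.mul (φ.continuous_normed.comp (continuous_const.sub continuous_id)))
        |>.integrable_of_hasCompactSupport
        (φ.hasCompactSupport_normed.comp_homeomorph (Homeomorph.subLeft x)).mul_left
    rw [hF, normed_convolution_eq, normed_convolution_eq,
      ← integral_add_right_eq_self (fun y ↦ f y * φ.normed volume (x + t • v - y)) (t • v)]
    simp only [add_sub_add_right_eq_sub]
    rw [← integral_sub hi1 hi2, ← integral_smul]
    refine integral_congr_ae (Eventually.of_forall fun y ↦ ?_)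
    simp only [smul_eq_mul]
    ring
  simp_rw [h2] at h1
  exact tendsto_nhds_unique h1
    (hf.integral_inv_smul_sub_mul_tendsto_integral_lineDeriv_mul (integrable_normed_sub φ x) v)

/-! ### The energy does not increase under mollification -/

/-- `‖Df‖²` is integrable for a compactly supported Lipschitz `f` (`Df` is measurable, bounded by the
Lipschitz constant, and vanishes off `tsupport f`). [folklore] -/
theorem integrable_norm_fderiv_sq (hf : LipschitzWith C f) (hfs : HasCompactSupport f) :
    Integrable (fun y ↦ ‖fderiv ℝ f y‖ ^ 2) volume := by
  have hmeas : AEStronglyMeasurable (fun y ↦ ‖fderiv ℝ f y‖ ^ 2) volume :=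
    ((measurable_fderiv ℝ f).norm.pow_const 2).aestronglyMeasurable
  have hsupp : Function.support (fun y ↦ ‖fderiv ℝ f y‖ ^ 2) ⊆ tsupport f := by
    intro y hy
    by_contra h
    exact hy (by simp [fderiv_of_notMem_tsupport ℝ h])
  rw [← integrableOn_iff_integrable_of_support_subset hsupp]
  refine Measure.integrableOn_of_bounded (M := (C : ℝ) ^ 2) hfs.isCompact.measure_lt_top.ne hmeas
    (Eventually.of_forall fun y ↦ ?_)
  rw [Real.norm_eq_abs, abs_pow, abs_norm]
  exact pow_le_pow_left₀ (norm_nonneg _) (norm_fderiv_le_of_lipschitz ℝ hf) 2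

/-- **Pointwise energy bound** (Jensen): `‖D(φ ⋆ f)_x‖² ≤ ∫ ‖Df_y‖² φ(x − y) dy` for a Lipschitz `f`:
`D(φ ⋆ f)_x(v) = ∫ Df_y(v) φ(x − y) dy` (Rademacher: `∂_v f = Df(v)` a.e.), so `‖D(φ ⋆ f)_x‖` is at most
the `φ(x − ·) dy`-average `M` of `‖Df‖`, and `M² ≤ ∫ ‖Df‖² φ(x − ·)` since the variance
`∫ (‖Df‖ − M)² φ(x − ·) dy` is non-negative. [folklore] -/
theorem norm_fderiv_normed_convolution_sq_le (φ : ContDiffBump (0 : EuclideanSpace ℝ (Fin n)))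
    (hf : LipschitzWith C f) (x : EuclideanSpace ℝ (Fin n)) :
    ‖fderiv ℝ (φ.normed volume ⋆ f) x‖ ^ 2 ≤ ∫ y, ‖fderiv ℝ f y‖ ^ 2 * φ.normed volume (x - y) := by
  set w : EuclideanSpace ℝ (Fin n) → ℝ := fun y ↦ φ.normed volume (x - y) with hw
  set G : EuclideanSpace ℝ (Fin n) → ℝ := fun y ↦ ‖fderiv ℝ f y‖ with hG
  have hw0 : ∀ y, 0 ≤ w y := fun y ↦ φ.nonneg_normed _
  have hw1 : ∫ y, w y = 1 := by
    rw [hw, integral_sub_left_eq_self (fun y ↦ φ.normed volume y) volume x]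
    exact φ.integral_normed
  have hGm : Measurable G := (measurable_fderiv ℝ f).norm
  have hGb : ∀ y, G y ≤ C := fun y ↦ norm_fderiv_le_of_lipschitz ℝ hf
  have hG0 : ∀ y, 0 ≤ G y := fun y ↦ norm_nonneg _
  have hwi : Integrable w volume := integrable_normed_sub φ x
  have hGwi : Integrable (fun y ↦ G y * w y) volume := by
    refine Integrable.mono' (hwi.const_mul C) (hGm.aestronglyMeasurable.mul hwi.aestronglyMeasurable)
      (Eventually.of_forall fun y ↦ ?_)
    rw [Real.norm_eq_abs, abs_mul, abs_of_nonneg (hG0 y), abs_of_nonneg (hw0 y)]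
    exact mul_le_mul_of_nonneg_right (hGb y) (hw0 y)
  have hG2wi : Integrable (fun y ↦ G y ^ 2 * w y) volume := by
    refine Integrable.mono' (hwi.const_mul ((C : ℝ) ^ 2))
      ((hGm.pow_const 2).aestronglyMeasurable.mul hwi.aestronglyMeasurable)
      (Eventually.of_forall fun y ↦ ?_)
    rw [Real.norm_eq_abs, abs_mul, abs_of_nonneg (sq_nonneg _), abs_of_nonneg (hw0 y)]
    exact mul_le_mul_of_nonneg_right (pow_le_pow_left₀ (hG0 y) (hGb y) 2) (hw0 y)
  -- the derivative, with `fderiv` in place of `lineDeriv` (Rademacher)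
  have hD : ∀ v, fderiv ℝ (φ.normed volume ⋆ f) x v = ∫ y, fderiv ℝ f y v * w y := by
    intro v
    rw [fderiv_normed_convolution_apply φ hf x v]
    refine integral_congr_ae ?_
    filter_upwards [hf.ae_differentiableAt (μ := volume)] with y hy
    rw [hy.lineDeriv_eq_fderiv]
  -- operator-norm bound by the average `M` of `‖Df‖`
  obtain ⟨M, hM⟩ : ∃ M : ℝ, M = ∫ y, G y * w y := ⟨_, rfl⟩
  have hM0 : 0 ≤ M := hM ▸ integral_nonneg fun y ↦ mul_nonneg (hG0 y) (hw0 y)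
  have hnorm : ‖fderiv ℝ (φ.normed volume ⋆ f) x‖ ≤ M := by
    refine ContinuousLinearMap.opNorm_le_bound _ hM0 fun v ↦ ?_
    rw [hD v, Real.norm_eq_abs]
    calc |∫ y, fderiv ℝ f y v * w y| ≤ ∫ y, |fderiv ℝ f y v * w y| := abs_integral_le_integral_abs
      _ ≤ ∫ y, G y * w y * ‖v‖ := by
          refine integral_mono_of_nonneg (Eventually.of_forall fun y ↦ abs_nonneg _)
            (hGwi.mul_const _) (Eventually.of_forall fun y ↦ ?_)
          change |fderiv ℝ f y v * w y| ≤ G y * w y * ‖v‖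
          rw [abs_mul, abs_of_nonneg (hw0 y)]
          have h1 : |fderiv ℝ f y v| ≤ G y * ‖v‖ := by
            rw [← Real.norm_eq_abs]
            exact (fderiv ℝ f y).le_opNorm v
          nlinarith [hw0 y, h1]
      _ = M * ‖v‖ := by rw [integral_mul_const, hM]
  -- Jensen through the variance
  have hvar : M ^ 2 ≤ ∫ y, G y ^ 2 * w y := by
    have h0 : 0 ≤ ∫ y, (G y - M) ^ 2 * w y :=
      integral_nonneg fun y ↦ mul_nonneg (sq_nonneg _) (hw0 y)
    have e : (fun y ↦ (G y - M) ^ 2 * w y) =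
        fun y ↦ (G y ^ 2 * w y - 2 * M * (G y * w y)) + M ^ 2 * w y := by
      funext y; ring
    rw [e] at h0
    have hsplit : ∫ y, G y ^ 2 * w y - 2 * M * (G y * w y) + M ^ 2 * w y =
        (∫ y, G y ^ 2 * w y) - 2 * M * M + M ^ 2 * 1 := by
      rw [integral_add, integral_sub, integral_const_mul, integral_const_mul, hw1, ← hM]
      · exact hG2wi
      · exact hGwi.const_mul _
      · exact hG2wi.sub (hGwi.const_mul _)
      · exact hwi.const_mul _
    rw [hsplit] at h0
    nlinarith [h0]
  calc ‖fderiv ℝ (φ.normed volume ⋆ f) x‖ ^ 2 ≤ M ^ 2 := pow_le_pow_left₀ (norm_nonneg _) hnorm 2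
    _ ≤ ∫ y, G y ^ 2 * w y := hvar

/-- **The Dirichlet energy does not increase under mollification**:
`∫ ‖D(φ ⋆ f)‖² dx ≤ ∫ ‖Df‖² dx` for a compactly supported Lipschitz `f` (integrate the pointwise bound;
`∫ (‖Df‖² ⋆ φ) = ∫ ‖Df‖² · ∫ φ`). [folklore] -/
theorem integral_norm_fderiv_normed_convolution_sq_le
    (φ : ContDiffBump (0 : EuclideanSpace ℝ (Fin n))) (hf : LipschitzWith C f)
    (hfs : HasCompactSupport f) :
    ∫ x, ‖fderiv ℝ (φ.normed volume ⋆ f) x‖ ^ 2 ≤ ∫ y, ‖fderiv ℝ f y‖ ^ 2 := by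
  have hG2 : Integrable (fun y ↦ ‖fderiv ℝ f y‖ ^ 2) volume := integrable_norm_fderiv_sq hf hfs
  have hconv : ∀ x, ∫ y, ‖fderiv ℝ f y‖ ^ 2 * φ.normed volume (x - y) =
      ((fun y ↦ ‖fderiv ℝ f y‖ ^ 2) ⋆ φ.normed volume) x := by
    intro x
    rw [convolution_def]
    simp only [lsmul_apply, smul_eq_mul]
  have hint : ∫ x, ((fun y ↦ ‖fderiv ℝ f y‖ ^ 2) ⋆ φ.normed volume) x = ∫ y, ‖fderiv ℝ f y‖ ^ 2 := by
    rw [integral_convolution (L := lsmul ℝ ℝ) hG2 φ.integrable_normed, lsmul_apply, φ.integral_normed,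
      smul_eq_mul, mul_one]
  rw [← hint]
  have hFd := contDiff_normed_convolution φ hf.continuous
  have hFs := hasCompactSupport_normed_convolution φ hfs
  refine integral_mono ?_ (hG2.integrable_convolution _ φ.integrable_normed) fun x ↦ ?_
  · exact ((hFd.continuous_fderiv one_ne_zero).norm.pow 2).integrable_of_hasCompactSupport
      (hasCompactSupport_sq (hFs.fderiv ℝ).norm)
  · exact (norm_fderiv_normed_convolution_sq_le φ hf x).trans (hconv x).le

end Mollify

/-! ### The inequality for Lipschitz functions -/

/-- **Homogeneous form of the sharp inequality** for `g ∈ C¹_c(ℝⁿ)` with `a = ∫ g² dx > 0`: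
`∫ g² log g² − a log a ≤ 4τ ∫ ‖Dg‖² − a (n + (n/2) log(4πτ))` (`euclideanLogSobolev_scale` for
`g/√a`). [cite: BakryGentilLedoux2014, Prop. 6.2.5 (p. 284)] -/
theorem euclideanLogSobolev_scale_homogeneous {g : EuclideanSpace ℝ (Fin n) → ℝ}
    (hg : ContDiff ℝ 1 g) (hgs : HasCompactSupport g) (ha : 0 < ∫ x, g x ^ 2) {τ : ℝ} (hτ : 0 < τ) :
    (∫ x, g x ^ 2 * Real.log (g x ^ 2)) - (∫ x, g x ^ 2) * Real.log (∫ x, g x ^ 2) ≤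
      4 * τ * (∫ x, ‖fderiv ℝ g x‖ ^ 2) -
        (∫ x, g x ^ 2) * (n + (n : ℝ) / 2 * Real.log (4 * Real.pi * τ)) := by
  obtain ⟨a, haE⟩ : ∃ a : ℝ, a = ∫ x, g x ^ 2 := ⟨_, rfl⟩
  rw [← haE] at ha ⊢
  have hsa : 0 < Real.sqrt a := Real.sqrt_pos.2 ha
  set u : EuclideanSpace ℝ (Fin n) → ℝ := fun x ↦ (Real.sqrt a)⁻¹ * g x with hu_def
  have hgd : Differentiable ℝ g := hg.differentiable one_ne_zero
  have hu : ContDiff ℝ 1 u := contDiff_const.mul hg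
  have hus : HasCompactSupport u := hgs.mul_left
  have hu2 : ∀ x, u x ^ 2 = a⁻¹ * g x ^ 2 := by
    intro x
    rw [hu_def, mul_pow, inv_pow, Real.sq_sqrt ha.le]
  have hu1 : ∫ x, u x ^ 2 = 1 := by
    simp_rw [hu2, integral_const_mul]
    rw [← haE]
    exact inv_mul_cancel₀ ha.ne'
  have hDu : ∀ x, fderiv ℝ u x = (Real.sqrt a)⁻¹ • fderiv ℝ g x := fun x ↦
    ((hgd x).hasFDerivAt.const_mul (Real.sqrt a)⁻¹).fderiv
  have hDu2 : ∀ x, ‖fderiv ℝ u x‖ ^ 2 = a⁻¹ * ‖fderiv ℝ g x‖ ^ 2 := by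
    intro x
    rw [hDu, norm_smul, mul_pow, Real.norm_eq_abs, abs_inv, abs_of_pos hsa, inv_pow,
      Real.sq_sqrt ha.le]
  have hent : ∀ x, u x ^ 2 * Real.log (u x ^ 2) =
      a⁻¹ * (g x ^ 2 * Real.log (g x ^ 2) - Real.log a * g x ^ 2) := by
    intro x
    rw [hu2]
    by_cases h0 : g x = 0
    · simp [h0]
    · rw [Real.log_mul (inv_ne_zero ha.ne') (pow_ne_zero 2 h0), Real.log_inv]
      ring
  have h := euclideanLogSobolev_scale hu hus hu1 hτ
  have hg2c : Continuous fun x ↦ g x ^ 2 := hg.continuous.pow 2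
  have hi1 : Integrable (fun x ↦ g x ^ 2 * Real.log (g x ^ 2)) volume :=
    (Real.continuous_mul_log.comp hg2c).integrable_of_hasCompactSupport (hasCompactSupport_sq_mul_log hgs)
  have hi2 : Integrable (fun x ↦ Real.log a * g x ^ 2) volume :=
    (hg2c.integrable_of_hasCompactSupport (hasCompactSupport_sq hgs)).const_mul _
  simp_rw [hent, hDu2, integral_const_mul] at h
  rw [integral_sub hi1 hi2, integral_const_mul, ← haE] at h
  -- `h : a⁻¹ (E − log a · a) ≤ 4τ (a⁻¹ D) − n − (n/2) log(4πτ)`; multiply by `a > 0`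
  have h' := mul_le_mul_of_nonneg_left h ha.le
  have e1 : a * (a⁻¹ * ((∫ x, g x ^ 2 * Real.log (g x ^ 2)) - Real.log a * a)) =
      (∫ x, g x ^ 2 * Real.log (g x ^ 2)) - a * Real.log a := by
    rw [← mul_assoc, mul_inv_cancel₀ ha.ne', one_mul, mul_comm (Real.log a) a]
  have e2 : a * (4 * τ * (a⁻¹ * ∫ x, ‖fderiv ℝ g x‖ ^ 2) - n - (n : ℝ) / 2 * Real.log (4 * Real.pi * τ)) =
      4 * τ * (∫ x, ‖fderiv ℝ g x‖ ^ 2) - a * (n + (n : ℝ) / 2 * Real.log (4 * Real.pi * τ)) := by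
    have : a * (4 * τ * (a⁻¹ * ∫ x, ‖fderiv ℝ g x‖ ^ 2)) = 4 * τ * (∫ x, ‖fderiv ℝ g x‖ ^ 2) := by
      calc a * (4 * τ * (a⁻¹ * ∫ x, ‖fderiv ℝ g x‖ ^ 2))
          = (a * a⁻¹) * (4 * τ * ∫ x, ‖fderiv ℝ g x‖ ^ 2) := by ring
        _ = 4 * τ * (∫ x, ‖fderiv ℝ g x‖ ^ 2) := by rw [mul_inv_cancel₀ ha.ne', one_mul]
    rw [mul_sub, mul_sub, this]
    ring
  rw [e1, e2] at h'
  exact h'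

/-- **The sharp Euclidean logarithmic Sobolev inequality for Lipschitz functions (scale form).**
For a compactly supported Lipschitz `f : ℝⁿ → ℝ` with `∫ f² dx = 1` and every `τ > 0`,
`∫ f² log f² dx ≤ 4τ ∫ ‖Df‖² dx − n − (n/2) log(4πτ)`, `Df` being the a.e.-defined (Rademacher)
Fréchet derivative (`fderiv`, `= 0` where `f` is not differentiable). Proof: mollify, `f_k = φ_k ⋆ f`
with normed bump functions of radius `1/(k+1)`; `f_k → f` uniformly with supports in a fixed compact
set, so `∫ f_k² → 1` and `∫ f_k² log f_k² → ∫ f² log f²` (dominated convergence), while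
`∫ ‖Df_k‖² ≤ ∫ ‖Df‖²` (`integral_norm_fderiv_normed_convolution_sq_le`); pass to the limit in the
homogeneous `C¹` inequality `euclideanLogSobolev_scale_homogeneous`. This is the form in which the
inequality is applied to rearrangements (which are Lipschitz, not `C¹`) in Balogh–Kristály–Tripaldi
2024, §3.1. [cite: BakryGentilLedoux2014, Prop. 6.2.5 (p. 284); BaloghKristalyTripaldi2024, (2.5), §3.1] -/
theorem euclideanLogSobolev_scale_of_lipschitz {f : EuclideanSpace ℝ (Fin n) → ℝ} {C : ℝ≥0}
    (hf : LipschitzWith C f) (hfs : HasCompactSupport f) (h1 : ∫ x, f x ^ 2 = 1) {τ : ℝ}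
    (hτ : 0 < τ) :
    ∫ x, f x ^ 2 * Real.log (f x ^ 2) ≤
      4 * τ * (∫ x, ‖fderiv ℝ f x‖ ^ 2) - n - (n : ℝ) / 2 * Real.log (4 * Real.pi * τ) := by
  -- a sequence of normed bump functions of radius `1/(k+1)`
  obtain ⟨φ, hφ⟩ : ∃ φ : ℕ → ContDiffBump (0 : EuclideanSpace ℝ (Fin n)),
      ∀ k, (φ k).rOut = 1 / ((k : ℝ) + 1) :=
    ⟨fun k ↦ ⟨1 / ((k : ℝ) + 2), 1 / ((k : ℝ) + 1), by positivity,
      one_div_lt_one_div_of_lt (by positivity) (by linarith)⟩, fun k ↦ rfl⟩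
  set F : ℕ → EuclideanSpace ℝ (Fin n) → ℝ := fun k ↦ (φ k).normed volume ⋆ f with hF
  have hFd : ∀ k, ContDiff ℝ 1 (F k) := fun k ↦ contDiff_normed_convolution (φ k) hf.continuous
  have hFs : ∀ k, HasCompactSupport (F k) := fun k ↦ hasCompactSupport_normed_convolution (φ k) hfs
  -- pointwise convergence `F k x → f x`
  have hptw : ∀ x, Tendsto (fun k ↦ F k x) atTop (𝓝 (f x)) := by
    intro x
    rw [tendsto_iff_dist_tendsto_zero]
    have hd : ∀ k, dist (F k x) (f x) ≤ C * (1 / ((k : ℝ) + 1)) := fun k ↦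
      (hφ k) ▸ dist_normed_convolution_le_of_lipschitz (φ k) hf x
    refine squeeze_zero (fun k ↦ dist_nonneg) hd ?_
    simpa using (tendsto_one_div_add_atTop_nhds_zero_nat (𝕜 := ℝ)).const_mul (C : ℝ)
  -- uniform bound and common compact support
  obtain ⟨B, hB⟩ : ∃ B : ℝ, ∀ y, |f y| ≤ B := by
    obtain ⟨B, hB⟩ := hf.continuous.bounded_above_of_compact_support hfs
    exact ⟨B, fun y ↦ by simpa only [Real.norm_eq_abs] using hB y⟩
  have hFB : ∀ k x, |F k x| ≤ B := fun k x ↦ abs_normed_convolution_le (φ k) hB x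
  set K : Set (EuclideanSpace ℝ (Fin n)) := cthickening 1 (tsupport f) with hK_def
  have hK : IsCompact K := hfs.isCompact.cthickening
  have hFK : ∀ k x, x ∉ K → F k x = 0 := by
    intro k x hx
    refine normed_convolution_eq_zero_of_infDist (φ k) fun hx' ↦ hx ?_
    have hr : (φ k).rOut ≤ 1 := by
      rw [hφ k, div_le_one (by positivity)]
      linarith [(k.cast_nonneg : (0 : ℝ) ≤ k)]
    exact ((thickening_mono hr _).trans ((thickening_subset_cthickening 1 _).trans
      (cthickening_subset_of_subset 1 (subset_tsupport f)))) hx'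
  have hKi : ∀ c : ℝ, Integrable (K.indicator fun _ ↦ c) volume := fun c ↦
    (integrable_indicator_iff hK.measurableSet).2 (integrableOn_const hK.measure_lt_top.ne)
  -- `∫ F_k² → ∫ f² = 1`
  have ha : Tendsto (fun k ↦ ∫ x, F k x ^ 2) atTop (𝓝 1) := by
    rw [← h1]
    refine tendsto_integral_of_dominated_convergence (K.indicator fun _ ↦ B ^ 2)
      (fun k ↦ ((hFd k).continuous.pow 2).aestronglyMeasurable) (hKi _) (fun k ↦ ?_) ?_
    · refine Eventually.of_forall fun x ↦ ?_
      by_cases hx : x ∈ K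
      · rw [indicator_of_mem hx, Real.norm_eq_abs, abs_pow]
        exact pow_le_pow_left₀ (abs_nonneg _) (hFB k x) 2
      · rw [indicator_of_notMem hx, hFK k x hx]
        simp
    · exact Eventually.of_forall fun x ↦ (hptw x).pow 2
  -- `∫ F_k² log F_k² → ∫ f² log f²`
  have hcont : Continuous fun s : ℝ ↦ s ^ 2 * Real.log (s ^ 2) :=
    Real.continuous_mul_log.comp (continuous_pow 2)
  obtain ⟨B', hB'⟩ : ∃ B' : ℝ, ∀ s : ℝ, |s| ≤ B → |s ^ 2 * Real.log (s ^ 2)| ≤ B' := by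
    obtain ⟨B', hB'⟩ := (isCompact_Icc : IsCompact (Icc (-B) B)).exists_bound_of_continuousOn
      hcont.continuousOn
    exact ⟨B', fun s hs ↦ by simpa only [Real.norm_eq_abs] using hB' s (mem_Icc.2 (abs_le.1 hs))⟩
  have he : Tendsto (fun k ↦ ∫ x, F k x ^ 2 * Real.log (F k x ^ 2)) atTop
      (𝓝 (∫ x, f x ^ 2 * Real.log (f x ^ 2))) := by
    refine tendsto_integral_of_dominated_convergence (K.indicator fun _ ↦ B')
      (fun k ↦ (hcont.comp (hFd k).continuous).aestronglyMeasurable) (hKi _) (fun k ↦ ?_) ?_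
    · refine Eventually.of_forall fun x ↦ ?_
      by_cases hx : x ∈ K
      · rw [indicator_of_mem hx, Real.norm_eq_abs]
        exact hB' _ (hFB k x)
      · rw [indicator_of_notMem hx, hFK k x hx]
        simp
    · exact Eventually.of_forall fun x ↦ (hcont.tendsto _).comp (hptw x)
  -- the homogeneous `C¹` inequality for `F k`, with the energy of `f` (eventually `∫ F_k² > 0`)
  have hev : ∀ᶠ k in atTop, 0 < ∫ x, F k x ^ 2 := (tendsto_order.1 ha).1 0 one_pos
  obtain ⟨c, hc⟩ : ∃ c : ℝ, c = n + (n : ℝ) / 2 * Real.log (4 * Real.pi * τ) := ⟨_, rfl⟩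
  have hineq : ∀ᶠ k in atTop,
      (∫ x, F k x ^ 2 * Real.log (F k x ^ 2)) - (∫ x, F k x ^ 2) * Real.log (∫ x, F k x ^ 2) +
        (∫ x, F k x ^ 2) * c ≤ 4 * τ * (∫ x, ‖fderiv ℝ f x‖ ^ 2) := by
    filter_upwards [hev] with k hk
    have h := euclideanLogSobolev_scale_homogeneous (hFd k) (hFs k) hk hτ
    rw [← hc] at h
    have hE : ∫ x, ‖fderiv ℝ (F k) x‖ ^ 2 ≤ ∫ x, ‖fderiv ℝ f x‖ ^ 2 :=
      integral_norm_fderiv_normed_convolution_sq_le (φ k) hf hfs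
    have hE' := mul_le_mul_of_nonneg_left hE (by positivity : (0 : ℝ) ≤ 4 * τ)
    linarith
  -- pass to the limit
  have hlim : Tendsto (fun k ↦ (∫ x, F k x ^ 2 * Real.log (F k x ^ 2)) -
      (∫ x, F k x ^ 2) * Real.log (∫ x, F k x ^ 2) + (∫ x, F k x ^ 2) * c) atTop
      (𝓝 ((∫ x, f x ^ 2 * Real.log (f x ^ 2)) - 1 * Real.log 1 + 1 * c)) :=
    (he.sub (ha.mul (ha.log one_ne_zero))).add (ha.mul_const c)
  have hfin := le_of_tendsto hlim hineq
  rw [Real.log_one, mul_zero, sub_zero, one_mul, hc] at hfin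
  linarith

/-- The case `n = 4` in the numeric shape of `Literature.Geometry.Riemannian.sharpLogSobolevAVR_four`
(`θ = 1`), for Lipschitz test functions. [cite: BakryGentilLedoux2014, Prop. 6.2.5 (p. 284)] -/
theorem euclideanLogSobolev_scale_four_of_lipschitz {f : EuclideanSpace ℝ (Fin 4) → ℝ} {C : ℝ≥0}
    (hf : LipschitzWith C f) (hfs : HasCompactSupport f) (h1 : ∫ x, f x ^ 2 = 1) {τ : ℝ}
    (hτ : 0 < τ) :
    ∫ x, f x ^ 2 * Real.log (f x ^ 2) ≤
      4 * τ * (∫ x, ‖fderiv ℝ f x‖ ^ 2) - 2 * Real.log (4 * Real.pi * τ) - 4 := by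
  have h := euclideanLogSobolev_scale_of_lipschitz hf hfs h1 hτ
  simp only [Nat.cast_ofNat] at h
  linarith

/-! ### The homogeneous inequality for Lipschitz functions -/

/-- **Homogeneous form of the sharp inequality for Lipschitz functions**: for a compactly
supported Lipschitz `g : ℝⁿ → ℝ` with `a = ∫ g² dx > 0` and every `τ > 0`,
`∫ g² log g² − a log a ≤ 4τ ∫ ‖Dg‖² − a (n + (n/2) log(4πτ))`
(`euclideanLogSobolev_scale_of_lipschitz` for `g/√a`; `Dg` the a.e. Fréchet derivative).
[cite: BakryGentilLedoux2014, Prop. 6.2.5 (p. 284)] -/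
theorem euclideanLogSobolev_scale_homogeneous_of_lipschitz {g : EuclideanSpace ℝ (Fin n) → ℝ}
    {C : ℝ≥0} (hg : LipschitzWith C g) (hgs : HasCompactSupport g) (ha : 0 < ∫ x, g x ^ 2)
    {τ : ℝ} (hτ : 0 < τ) :
    (∫ x, g x ^ 2 * Real.log (g x ^ 2)) - (∫ x, g x ^ 2) * Real.log (∫ x, g x ^ 2) ≤
      4 * τ * (∫ x, ‖fderiv ℝ g x‖ ^ 2) -
        (∫ x, g x ^ 2) * (n + (n : ℝ) / 2 * Real.log (4 * Real.pi * τ)) := by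
  obtain ⟨a, haE⟩ : ∃ a : ℝ, a = ∫ x, g x ^ 2 := ⟨_, rfl⟩
  rw [← haE] at ha ⊢
  have hsa : 0 < Real.sqrt a := Real.sqrt_pos.2 ha
  set u : EuclideanSpace ℝ (Fin n) → ℝ := fun x ↦ (Real.sqrt a)⁻¹ * g x with hu_def
  have hu : LipschitzWith (‖(Real.sqrt a)⁻¹‖₊ * C) u :=
    (lipschitzWith_smul (Real.sqrt a)⁻¹).comp hg
  have hus : HasCompactSupport u := hgs.mul_left
  have hu2 : ∀ x, u x ^ 2 = a⁻¹ * g x ^ 2 := by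
    intro x
    rw [hu_def, mul_pow, inv_pow, Real.sq_sqrt ha.le]
  have hu1 : ∫ x, u x ^ 2 = 1 := by
    simp_rw [hu2, integral_const_mul]
    rw [← haE]
    exact inv_mul_cancel₀ ha.ne'
  -- `Du = (√a)⁻¹ Dg` everywhere (both sides vanish where `g` is not differentiable)
  have hDu : ∀ x, fderiv ℝ u x = (Real.sqrt a)⁻¹ • fderiv ℝ g x := by
    intro x
    by_cases hx : DifferentiableAt ℝ g x
    · exact (hx.hasFDerivAt.const_mul (Real.sqrt a)⁻¹).fderiv
    · have hx' : ¬ DifferentiableAt ℝ u x := by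
        intro hux
        apply hx
        have : g = fun y ↦ Real.sqrt a * u y := by
          funext y
          rw [hu_def]
          field_simp
        rw [this]
        exact hux.const_mul _
      rw [fderiv_zero_of_not_differentiableAt hx, fderiv_zero_of_not_differentiableAt hx',
        smul_zero]
  have hDu2 : ∀ x, ‖fderiv ℝ u x‖ ^ 2 = a⁻¹ * ‖fderiv ℝ g x‖ ^ 2 := by
    intro x
    rw [hDu, norm_smul, mul_pow, Real.norm_eq_abs, abs_inv, abs_of_pos hsa, inv_pow,
      Real.sq_sqrt ha.le]
  have hent : ∀ x, u x ^ 2 * Real.log (u x ^ 2) =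
      a⁻¹ * (g x ^ 2 * Real.log (g x ^ 2) - Real.log a * g x ^ 2) := by
    intro x
    rw [hu2]
    by_cases h0 : g x = 0
    · simp [h0]
    · rw [Real.log_mul (inv_ne_zero ha.ne') (pow_ne_zero 2 h0), Real.log_inv]
      ring
  have h := euclideanLogSobolev_scale_of_lipschitz hu hus hu1 hτ
  have hg2c : Continuous fun x ↦ g x ^ 2 := hg.continuous.pow 2
  have hi1 : Integrable (fun x ↦ g x ^ 2 * Real.log (g x ^ 2)) volume :=
    (Real.continuous_mul_log.comp hg2c).integrable_of_hasCompactSupport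
      (hasCompactSupport_sq_mul_log hgs)
  have hi2 : Integrable (fun x ↦ Real.log a * g x ^ 2) volume :=
    (hg2c.integrable_of_hasCompactSupport (hasCompactSupport_sq hgs)).const_mul _
  simp_rw [hent, hDu2, integral_const_mul] at h
  rw [integral_sub hi1 hi2, integral_const_mul, ← haE] at h
  have h' := mul_le_mul_of_nonneg_left h ha.le
  have e1 : a * (a⁻¹ * ((∫ x, g x ^ 2 * Real.log (g x ^ 2)) - Real.log a * a)) =
      (∫ x, g x ^ 2 * Real.log (g x ^ 2)) - a * Real.log a := by
    rw [← mul_assoc, mul_inv_cancel₀ ha.ne', one_mul, mul_comm (Real.log a) a]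
  have e2 : a * (4 * τ * (a⁻¹ * ∫ x, ‖fderiv ℝ g x‖ ^ 2) - n -
      (n : ℝ) / 2 * Real.log (4 * Real.pi * τ)) =
      4 * τ * (∫ x, ‖fderiv ℝ g x‖ ^ 2) - a * (n + (n : ℝ) / 2 * Real.log (4 * Real.pi * τ)) := by
    have : a * (4 * τ * (a⁻¹ * ∫ x, ‖fderiv ℝ g x‖ ^ 2)) = 4 * τ * (∫ x, ‖fderiv ℝ g x‖ ^ 2) := by
      calc a * (4 * τ * (a⁻¹ * ∫ x, ‖fderiv ℝ g x‖ ^ 2))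
          = (a * a⁻¹) * (4 * τ * ∫ x, ‖fderiv ℝ g x‖ ^ 2) := by ring
        _ = 4 * τ * (∫ x, ‖fderiv ℝ g x‖ ^ 2) := by rw [mul_inv_cancel₀ ha.ne', one_mul]
    rw [mul_sub, mul_sub, this]
    ring
  rw [e1, e2] at h'
  exact h'

/-- The case `n = 4` of `euclideanLogSobolev_scale_homogeneous_of_lipschitz`, in the numeric
shape used by `Literature.Geometry.Riemannian.sharpLogSobolevAVR_four`.
[cite: BakryGentilLedoux2014, Prop. 6.2.5 (p. 284)] -/
theorem euclideanLogSobolev_scale_homogeneous_four_of_lipschitz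
    {g : EuclideanSpace ℝ (Fin 4) → ℝ} {C : ℝ≥0} (hg : LipschitzWith C g)
    (hgs : HasCompactSupport g) (ha : 0 < ∫ x, g x ^ 2) {τ : ℝ} (hτ : 0 < τ) :
    (∫ x, g x ^ 2 * Real.log (g x ^ 2)) - (∫ x, g x ^ 2) * Real.log (∫ x, g x ^ 2) ≤
      4 * τ * (∫ x, ‖fderiv ℝ g x‖ ^ 2) -
        (∫ x, g x ^ 2) * (4 + 2 * Real.log (4 * Real.pi * τ)) := by
  have h := euclideanLogSobolev_scale_homogeneous_of_lipschitz hg hgs ha hτ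
  simp only [Nat.cast_ofNat] at h
  rw [show (4 : ℝ) / 2 = 2 by norm_num] at h
  exact h

end Literature.Analysis.FunctionSpaces
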